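import Mathlib.MeasureTheory.Integral.Bochner.Basic
import Mathlib.MeasureTheory.Function.L2Space
import Mathlib.MeasureTheory.Integral.Bochner.ContinuousLinearMap
import Mathlib.Topology.ContinuousMap.CompactlySupported
import Literature.NumberTheory.Automorphic.HilbertRepSpectrumProofs
import Literature.NumberTheory.Automorphic.HeckeEigenvectorProjection
import HarnessLib

/-!
# Integrated operators `π(f) = ∫ f(g) π(g) dg` of a unitary representation (towards discreteness)

For a unitary, strongly continuous representation `π` of a topological group `G` on a complex
Hilbert space `H`, a measure `η` on `G` finite on compact sets (a Haar measure in applications)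
and `f ∈ C_c(G)` (Mathlib `CompactlySupportedContinuousMap`, notation `C_c(G, ℂ)`), the
**integrated operator** `π(f) v = ∫ f(g) • π(g) v dη(g)` (Bochner integral in `H`; Deitmar–Echterhoff,
*Principles of harmonic analysis* (2014), Prop. 6.2.1 and the remark after it: "alternatively, one
can define `π(f)` as the Bochner integral"), with:

* `ContRepresentation.integratedOperator` (a bounded operator, `‖π(f) v‖ ≤ ‖f‖₁ ‖v‖`,
  `norm_integratedOperator_apply_le`);
* `integratedOperator_apply_mem`: `π(f)` maps every closed `π`-invariant subspace into itself;
* `exists_nhds_integratedOperator_apply_ne_zero`: for `v ≠ 0` there is a neighbourhood `U` of `1`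
  such that `π(f) v ≠ 0` for every non-negative `f ∈ C_c(G)` supported in `U` with `∫ f > 0`
  (the Dirac-function estimate `‖π(f) v - v‖ ≤ ∫ f(g) ‖π(g) v - v‖ dg`, Deitmar–Echterhoff (2014),
  Lemma 6.2.2);
* `ClosedSubrep.exists_isCompactOperator_family_integrated` (**input to the discreteness
  criterion**, Deitmar–Echterhoff (2014), Lemma 9.2.7; Getz–Hahn (2024), Lemma 9.3.1): if `W` is a
  closed invariant subspace and `𝓕 ⊆ C_c(G)` a family containing non-negative functions of positive
  integral supported in any neighbourhood of `1` (e.g. a Dirac net) such that `π(f)|_W` is a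
  compact operator for every `f ∈ 𝓕`, then the operators `π(f)|_W`, `f ∈ 𝓕`, form a family `𝒯`
  of compact operators on `W` mapping every closed invariant subspace of `W` into itself and
  non-degenerate on each non-zero one — exactly the hypotheses of the tree's abstract criterion
  `IsUnitary.isDiscretelyDecomposable_of_isCompactOperator` (`DiscreteDecompositionCriterion`,
  applied to the unitary representation `W.toContRep`), which then yields that `W` is the closed
  span of its irreducible closed invariant subspaces. No adjoint formula `π(f)* = π(f*)`, hence no
  unimodularity, is needed. (The one-line combination with the criterion is left to the consumer,
  so that this file does not depend on it.)

This is the functional-analytic glue between the Gelfand–Piatetski-Shapiro compactness theorem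
(`R(f)` compact on `L²_cusp`) and the discrete decomposition of `L²_cusp` (`GLnCuspidalSpectrum`,
`AutomorphicGLn`).

## Mathlib

Bochner integral API (`integral_add/smul/smul_const`, `norm_integral_le_of_norm_le`,
`integral_inner`, `Continuous.integrable_of_hasCompactSupport`), `CompactlySupportedContinuousMap`,
`Submodule.orthogonal_orthogonal`, `IsCompactOperator.codRestrict`. Mathlib has no integrated form
of a group representation (its
`ContRepresentation` is a bare homomorphism into bounded operators); nothing here duplicates a
Mathlib declaration. Deliberate dot-notation extensions in `namespace ContRepresentation`, as in
`HilbertRepSpectrum`.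

## References

* A. Deitmar, S. Echterhoff, *Principles of harmonic analysis*, 2nd ed., Universitext, Springer
  (2014), Prop. 6.2.1, Lemma 6.2.2, §9.2 Lemma 9.2.7.
* J. R. Getz, H. Hahn, *An introduction to automorphic representations*, GTM 300 (2024), §9.3,
  Lemma 9.3.1 (Dirac sequences, `R(f_n) φ → φ`).
-/

noncomputable section

open scoped InnerProductSpace
open MeasureTheory Filter Topology CompactlySupported

namespace Literature.NumberTheory.Automorphic

/-- `x ↦ ‖f x‖ * c` is integrable for `f ∈ C_c(X)` and a measure finite on compact sets. [folklore] -/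
theorem integrable_norm_mul_const {X : Type*} [TopologicalSpace X] [MeasurableSpace X]
    [OpensMeasurableSpace X] (η : Measure X) [IsFiniteMeasureOnCompacts η] (f : C_c(X, ℂ))
    (c : ℝ) : Integrable (fun x => ‖f x‖ * c) η :=
  ((f.continuous.norm.integrable_of_hasCompactSupport f.hasCompactSupport.norm).mul_const c)

end Literature.NumberTheory.Automorphic

namespace ContRepresentation

open Literature.NumberTheory.Automorphic

section Integrand

variable {G H : Type*} [Group G] [TopologicalSpace G]
  [NormedAddCommGroup H] [InnerProductSpace ℂ H] {π : ContRepresentation ℂ G H}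

/-- The integrand `g ↦ f(g) • π(g) v` of `π(f) v` is continuous for strongly continuous `π`. [folklore] -/
theorem continuous_smul_apply (hc : π.IsStronglyContinuous) (f : C_c(G, ℂ)) (v : H) :
    Continuous fun g => f g • π g v :=
  f.continuous.smul (hc v)

/-- The integrand `g ↦ f(g) • π(g) v` of `π(f) v` has compact support. [folklore] -/
theorem hasCompactSupport_smul_apply (π : ContRepresentation ℂ G H) (f : C_c(G, ℂ)) (v : H) :
    HasCompactSupport fun g => f g • π g v :=
  (f.hasCompactSupport.smul_right : HasCompactSupport ((⇑f) • fun g => π g v))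

end Integrand

section Integrated

variable {G H : Type*} [Group G] [TopologicalSpace G] [MeasurableSpace G] [OpensMeasurableSpace G]
  [NormedAddCommGroup H] [InnerProductSpace ℂ H] [CompleteSpace H]
  {π : ContRepresentation ℂ G H}

omit [MeasurableSpace G] [OpensMeasurableSpace G] in
/-- Pointwise norm of the integrand for unitary `π`: `‖f(g) • π(g) v‖ = ‖f(g)‖ ‖v‖`. [folklore] -/
theorem norm_smul_apply (hu : π.IsUnitary) (f : C_c(G, ℂ)) (v : H) (g : G) :
    ‖f g • π g v‖ = ‖f g‖ * ‖v‖ := by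
  rw [norm_smul, hu.norm_map]

omit [CompleteSpace H] in
/-- The integrand `g ↦ f(g) • π(g) v` of `π(f) v` is Bochner integrable for a measure finite on
compact sets (Deitmar–Echterhoff (2014), proof of Prop. 6.2.1). [cite: DeitmarEchterhoff2014, Prop. 6.2.1] -/
theorem integrable_smul_apply (hc : π.IsStronglyContinuous) (η : Measure G)
    [IsFiniteMeasureOnCompacts η] (f : C_c(G, ℂ)) (v : H) :
    Integrable (fun g => f g • π g v) η :=
  (continuous_smul_apply hc f v).integrable_of_hasCompactSupport (hasCompactSupport_smul_apply π f v)

variable (π) in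
/-- The **integrated operator** `π(f) = ∫_G f(g) π(g) dη(g)` of a unitary, strongly continuous
representation `π` on a Hilbert space, for `f ∈ C_c(G)` and a measure `η` finite on compact sets
(a Haar measure in applications): `π(f) v = ∫ f(g) • π(g) v dη(g)` (Bochner integral), a bounded
operator with `‖π(f) v‖ ≤ ‖f‖_{L¹(η)} ‖v‖` (Deitmar–Echterhoff (2014), Prop. 6.2.1 and the remark
following it). [cite: DeitmarEchterhoff2014, Prop. 6.2.1] -/
def integratedOperator (hu : π.IsUnitary) (hc : π.IsStronglyContinuous) (η : Measure G)
    [IsFiniteMeasureOnCompacts η] (f : C_c(G, ℂ)) : H →L[ℂ] H :=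
  LinearMap.mkContinuous
    { toFun := fun v => ∫ g, f g • π g v ∂η
      map_add' := fun v w => by
        simp only [map_add, smul_add]
        exact integral_add (integrable_smul_apply hc η f v) (integrable_smul_apply hc η f w)
      map_smul' := fun c v => by
        simp only [map_smul, RingHom.id_apply]
        simp_rw [smul_comm (f _) c]
        exact integral_smul c _ }
    (∫ g, ‖f g‖ ∂η) fun v => by
      simp only [LinearMap.coe_mk, AddHom.coe_mk]
      calc ‖∫ g, f g • π g v ∂η‖ ≤ ∫ g, ‖f g‖ * ‖v‖ ∂η :=
            norm_integral_le_of_norm_le (integrable_norm_mul_const η f ‖v‖)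
              (Eventually.of_forall fun g => (norm_smul_apply hu f v g).le)
        _ = (∫ g, ‖f g‖ ∂η) * ‖v‖ := integral_mul_const _ _

/-- `π(f) v = ∫ f(g) • π(g) v dη(g)` (definitional). [folklore] -/
theorem integratedOperator_apply (hu : π.IsUnitary) (hc : π.IsStronglyContinuous) (η : Measure G)
    [IsFiniteMeasureOnCompacts η] (f : C_c(G, ℂ)) (v : H) :
    π.integratedOperator hu hc η f v = ∫ g, f g • π g v ∂η :=
  rfl

/-- `‖π(f) v‖ ≤ ‖f‖_{L¹(η)} ‖v‖` (Deitmar–Echterhoff (2014), Prop. 6.2.1). [cite: DeitmarEchterhoff2014, Prop. 6.2.1] -/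
theorem norm_integratedOperator_apply_le (hu : π.IsUnitary) (hc : π.IsStronglyContinuous)
    (η : Measure G) [IsFiniteMeasureOnCompacts η] (f : C_c(G, ℂ)) (v : H) :
    ‖π.integratedOperator hu hc η f v‖ ≤ (∫ g, ‖f g‖ ∂η) * ‖v‖ :=
  calc ‖∫ g, f g • π g v ∂η‖ ≤ ∫ g, ‖f g‖ * ‖v‖ ∂η :=
        norm_integral_le_of_norm_le (integrable_norm_mul_const η f ‖v‖)
          (Eventually.of_forall fun g => (norm_smul_apply hu f v g).le)
    _ = (∫ g, ‖f g‖ ∂η) * ‖v‖ := integral_mul_const _ _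

/-- **`π(f)` preserves closed invariant subspaces**: if `W` is a closed `π`-invariant subspace and
`v ∈ W` then `π(f) v ∈ W` (the integrand takes values in `W`; we check `π(f) v ⟂ Wᗮ` via
`⟪u, ∫ F⟫ = ∫ ⟪u, F⟫` and use `Wᗮᗮ = W`; Deitmar–Echterhoff (2014), §9.2). [folklore] -/
theorem integratedOperator_apply_mem (hu : π.IsUnitary) (hc : π.IsStronglyContinuous)
    (η : Measure G) [IsFiniteMeasureOnCompacts η] (f : C_c(G, ℂ)) (W : ClosedSubrep π) {v : H}
    (hv : v ∈ W) : π.integratedOperator hu hc η f v ∈ W := by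
  rw [← ClosedSubrep.mem_toSubmodule, ← Submodule.orthogonal_orthogonal W.toSubmodule,
    Submodule.mem_orthogonal]
  intro u hu'
  rw [integratedOperator_apply, ← integral_inner (integrable_smul_apply hc η f v) u]
  refine integral_eq_zero_of_ae (Eventually.of_forall fun g => ?_)
  exact Submodule.inner_left_of_mem_orthogonal
    (W.toSubmodule.smul_mem (f g) (W.apply_mem g hv)) hu'

/-- **Dirac-function estimate** (Deitmar–Echterhoff (2014), Lemma 6.2.2: `‖π(φ_U) v - v‖ ≤
∫ φ_U(g) ‖π(g) v - v‖ dg < ε` for `supp φ_U ⊆ U` small). In the form needed for discreteness: for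
`v ≠ 0` there is a neighbourhood `U` of `1` such that `π(f) v ≠ 0` for every real non-negative
`f ∈ C_c(G)` supported in `U` with `∫ f dη > 0` (indeed `‖π(f) v - (∫ f) v‖ ≤ (∫ f) ‖v‖ / 2`). [cite: DeitmarEchterhoff2014, Lemma 6.2.2] -/
theorem exists_nhds_integratedOperator_apply_ne_zero (hu : π.IsUnitary)
    (hc : π.IsStronglyContinuous) (η : Measure G) [IsFiniteMeasureOnCompacts η] {v : H}
    (hv : v ≠ 0) :
    ∃ U ∈ 𝓝 (1 : G), ∀ f : C_c(G, ℂ), (∀ g, 0 ≤ (f g).re ∧ (f g).im = 0) →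
      tsupport f ⊆ U → 0 < ∫ g, (f g).re ∂η → π.integratedOperator hu hc η f v ≠ 0 := by
  set U : Set G := {g | ‖π g v - v‖ < ‖v‖ / 2} with hU
  have hUo : IsOpen U := isOpen_lt ((hc v).sub continuous_const).norm continuous_const
  have h1U : (1 : G) ∈ U := by
    change ‖π 1 v - v‖ < ‖v‖ / 2
    rw [map_one]
    change ‖v - v‖ < ‖v‖ / 2
    rw [sub_self, norm_zero]
    exact half_pos (norm_pos_iff.mpr hv)
  refine ⟨U, hUo.mem_nhds h1U, fun f hf hfU hfpos h0 => ?_⟩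
  -- `f` is real-valued: `f g = (f g).re`
  have hfre : ∀ g, (f g : ℂ) = ((f g).re : ℂ) := fun g =>
    Complex.ext (by simp) (by simp [(hf g).2])
  set c : ℝ := ∫ g, (f g).re ∂η with hcdef
  -- `∫ f(g) • v = c • v`
  have hcv : ∫ g, f g • v ∂η = (c : ℂ) • v := by
    rw [integral_smul_const, hcdef, ← integral_complex_ofReal]
    congr 1
    exact integral_congr_ae (Eventually.of_forall fun g => hfre g)
  -- the estimate `‖π(f) v - c • v‖ ≤ c * (‖v‖ / 2)`
  have hint : Integrable (fun g => (f g).re * (‖v‖ / 2)) η :=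
    ((Complex.continuous_re.comp f.continuous).integrable_of_hasCompactSupport
      (f.hasCompactSupport.comp_left Complex.zero_re)).mul_const _
  have hint2 : Integrable (fun g => f g • v) η :=
    (f.continuous.smul continuous_const).integrable_of_hasCompactSupport
      (f.hasCompactSupport.smul_right : HasCompactSupport ((⇑f) • fun _ : G => v))
  have hest : ‖π.integratedOperator hu hc η f v - (c : ℂ) • v‖ ≤ c * (‖v‖ / 2) := by
    rw [integratedOperator_apply, ← hcv, ← integral_sub (integrable_smul_apply hc η f v) hint2]
    calc ‖∫ g, (f g • π g v - f g • v) ∂η‖ ≤ ∫ g, (f g).re * (‖v‖ / 2) ∂η := by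
          refine norm_integral_le_of_norm_le hint (Eventually.of_forall fun g => ?_)
          have hnorm : ‖f g‖ = (f g).re := by
            conv_lhs => rw [hfre g]
            rw [Complex.norm_real, Real.norm_of_nonneg (hf g).1]
          rw [← smul_sub, norm_smul, hnorm]
          by_cases hg : g ∈ U
          · exact mul_le_mul_of_nonneg_left hg.le (hf g).1
          · have hg' : g ∉ tsupport f := fun h => hg (hfU h)
            rw [image_eq_zero_of_notMem_tsupport hg']
            simp
      _ = c * (‖v‖ / 2) := integral_mul_const _ _
  -- if `π(f) v = 0` then `c ‖v‖ ≤ c ‖v‖ / 2`, impossible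
  rw [h0, zero_sub, norm_neg, norm_smul, Complex.norm_real, Real.norm_eq_abs,
    abs_of_pos hfpos] at hest
  have hvpos : 0 < ‖v‖ := norm_pos_iff.mpr hv
  nlinarith

end Integrated

/-! ### The discreteness criterion -/

section Criterion

variable {G H : Type*} [Group G] [TopologicalSpace G] [MeasurableSpace G] [OpensMeasurableSpace G]
  [NormedAddCommGroup H] [InnerProductSpace ℂ H] [CompleteSpace H]
  {π : ContRepresentation ℂ G H}

namespace ClosedSubrep

/-- The restriction `π(f)|_W : W → W` of an integrated operator to a closed invariant subspace
(well defined by `integratedOperator_apply_mem`). [folklore] -/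
def integratedOperatorRestrict (hu : π.IsUnitary) (hc : π.IsStronglyContinuous) (η : Measure G)
    [IsFiniteMeasureOnCompacts η] (W : ClosedSubrep π) (f : C_c(G, ℂ)) :
    W.toSubmodule →L[ℂ] W.toSubmodule :=
  (π.integratedOperator hu hc η f).restrict fun _ hv => integratedOperator_apply_mem hu hc η f W hv

/-- `π(f)|_W w = π(f) w` in `H`. [folklore] -/
@[simp]
theorem coe_integratedOperatorRestrict_apply (hu : π.IsUnitary) (hc : π.IsStronglyContinuous)
    (η : Measure G) [IsFiniteMeasureOnCompacts η] (W : ClosedSubrep π) (f : C_c(G, ℂ))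
    (w : W.toSubmodule) :
    (W.integratedOperatorRestrict hu hc η f w : H) = π.integratedOperator hu hc η f w :=
  rfl

/-- `π(f)|_W` preserves every closed invariant subspace of `W.toContRep`. [folklore] -/
theorem integratedOperatorRestrict_apply_mem (hu : π.IsUnitary) (hc : π.IsStronglyContinuous)
    (η : Measure G) [IsFiniteMeasureOnCompacts η] (W : ClosedSubrep π) (f : C_c(G, ℂ))
    (Q : ClosedSubrep W.toContRep) {w : W.toSubmodule} (hw : w ∈ Q) :
    W.integratedOperatorRestrict hu hc η f w ∈ Q := by
  rw [W.mk_mem_iff_mem_inflate Q]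
  exact integratedOperator_apply_mem hu hc η f (W.inflate Q) (W.coe_mem_inflate Q hw)

/-- **Input to the discreteness criterion** (Deitmar–Echterhoff (2014), Lemma 9.2.7: "the
condition `η(A) v ≠ 0` is always satisfied if `A` contains a Dirac net"; Getz–Hahn (2024),
Lemma 9.3.1). Let `π` be a unitary, strongly continuous representation of `G` on a complex Hilbert
space, `η` a measure on `G` finite on compact sets, `W` a closed invariant subspace, and
`𝓕 ⊆ C_c(G)` a family of test functions which contains, for every neighbourhood `U` of `1`, a
real non-negative function supported in `U` with positive integral (e.g. `𝓕 ⊇` a Dirac net), such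
that `π(f)|_W` is a compact operator for every `f ∈ 𝓕`. Then `𝒯 = {π(f)|_W : f ∈ 𝓕}` is a family
of compact operators on `W` which map every closed invariant subspace of `W.toContRep` into itself
and do not all vanish on any non-zero one (by `exists_nhds_integratedOperator_apply_ne_zero`) —
the hypotheses of `IsUnitary.isDiscretelyDecomposable_of_isCompactOperator`
(`DiscreteDecompositionCriterion`) for the unitary representation `W.toContRep`
(`IsUnitary.toContRep`), whose conclusion is that `W` is discretely decomposable. [cite: DeitmarEchterhoff2014, Lemma 9.2.7] -/
theorem exists_isCompactOperator_family_integrated (hu : π.IsUnitary)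
    (hc : π.IsStronglyContinuous) (η : Measure G) [IsFiniteMeasureOnCompacts η]
    (W : ClosedSubrep π) (𝓕 : Set C_c(G, ℂ))
    (h_dirac : ∀ U ∈ 𝓝 (1 : G), ∃ f ∈ 𝓕, (∀ g, 0 ≤ (f g).re ∧ (f g).im = 0) ∧
      tsupport f ⊆ U ∧ 0 < ∫ g, (f g).re ∂η)
    (h_compact : ∀ f ∈ 𝓕, IsCompactOperator fun w : W.toSubmodule =>
      π.integratedOperator hu hc η f (w : H)) :
    ∃ 𝒯 : Set (W.toSubmodule →L[ℂ] W.toSubmodule),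
      (∀ T ∈ 𝒯, IsCompactOperator T) ∧
      (∀ T ∈ 𝒯, ∀ Q : ClosedSubrep W.toContRep, ∀ w ∈ Q, T w ∈ Q) ∧
      (∀ Q : ClosedSubrep W.toContRep, Q ≠ ⊥ → ∃ T ∈ 𝒯, ∃ w ∈ Q, T w ≠ 0) := by
  have hS_compact : ∀ f ∈ 𝓕, IsCompactOperator (W.integratedOperatorRestrict hu hc η f) :=
    fun f hf => (h_compact f hf).codRestrict
      (fun w => integratedOperator_apply_mem hu hc η f W w.2) W.isClosed
  refine ⟨{T | ∃ f ∈ 𝓕, T = W.integratedOperatorRestrict hu hc η f}, ?_, ?_, ?_⟩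
  · rintro T ⟨f, hf, rfl⟩
    exact hS_compact f hf
  · rintro T ⟨f, hf, rfl⟩ Q w hw
    exact W.integratedOperatorRestrict_apply_mem hu hc η f Q hw
  · intro Q hQ
    obtain ⟨w, hwQ, hw0⟩ : ∃ w ∈ Q, w ≠ 0 := by
      by_contra! hall
      exact hQ (ClosedSubrep.ext fun w => by
        rw [ClosedSubrep.mem_bot]
        exact ⟨hall w, fun h => h ▸ Q.toSubmodule.zero_mem⟩)
    have hw' : (w : H) ≠ 0 := fun h => hw0 (Subtype.ext h)
    obtain ⟨U, hU, hUf⟩ := exists_nhds_integratedOperator_apply_ne_zero hu hc η hw'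
    obtain ⟨f, hf, hfre, hfU, hfpos⟩ := h_dirac U hU
    refine ⟨_, ⟨f, hf, rfl⟩, w, hwQ, fun h0 => hUf f hfre hfU hfpos ?_⟩
    exact congrArg Subtype.val h0

end ClosedSubrep

end Criterion

end ContRepresentation
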